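import Summits.QuantumFields.YangMills.Theorems.BalabanUVNodesN07ChartLogAnalytic
import HarnessLib

/-!
# BalabanUVNodes ∕ N07 — [15] PROPOSITION 3, (68)–(72) AT THE TRUE MULTI-LEVEL (0.4)-CONSTRAINT: LOCALITY of the derivative of the charted constraint (the read set of an
# index), (72) LOCALISED to the read set, and the FIXED-POINT IDENTITY `𝔇 = 𝒞′_{X₀}∘(1 − H∘𝔇)` of the chart's Fréchet derivative — generic carrier `P : Params`

Cell `pub-ymgap`, width seat `pub-ymgap-dag-n07-w2` generation 4 (HUMAN RULING D-0149; DAG node N07 = [15] = [Balaban1985Variational]; W-SEAT START LIST §n07 item 2 = S2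
«[15] Sect. C (47)–(49), Prop. 3 at objects» — generation 3's honest remainder «(73) WITH KERNEL DECAY», part 1 of 2; part 2 = `…N07ChartDDecay`).  `--kind proof
--supports stmt-QuantumFields-20542 --as helper` (K1⁷; count-neutral).  CONSUMED BY NAME, nothing modified: generation 3's `N07ChartLogAnalytic.{analyticOnNhd_chartLog_weightedBall,
norm_fderiv_chartLog_sub_fderiv_zero_le_weightedBall}` (analyticity on the weighted ball, the global (72)), the route `UnitScaleTilt`'s `Prop8Chart.{chartLog, chartLog_congr
(READ SET of an index), differentiableAt_chartLog_zero}`, dag k0-s1-w3's `K0FlatCubeOpsTextP.IsLevWeight`.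

THE PRINT ([15] pp. 288–289): «Let us denote by 𝔇(A′) the kernel of the derivative (δ∕δA′)D(A′) … we get the following equation for 𝔇(A′): 𝔇(A′; ·, b) +
Lʲη(δ∕δA)C(A′ − HD(A′))HL^{j(·)}η𝔇(A′; ·, b) = Lʲη(δ∕δA(b))C(A′ − HD(A′)) … (I + ℜ)𝔇(A′) = Lʲη(δ∕δA)C (68) … (69) … sup_{b ⊂ Bʲ(c₋)∪Bʲ(c₊)} … Proposition 5 of [4]
implies that |Lʲη(δC_j∕δA)(Lʲη(A′ − HD(A′)))| ≤ Lʲη(Lʲη)^{−d}C₃2ε₃ (72)».  The functional `C_j(·, c)` reads the field only on the bonds under the two `j`-blocks of `c`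
([4] (9), tree: `Prop8Chart.chartLog_congr`).

WHAT IS PROVED (sorry-free; no definition; axioms standard).
§1 `hasFDerivAt_chartLog_apply_eq_of_reads`, ★ `fderiv_chartLog_apply_eq_of_reads` — LOCALITY OF THE DERIVATIVE: at any point of differentiability `(D chartLog(Y) V)(j,c) =
(D chartLog(Y) V′)(j,c)` whenever `V`, `V′` agree on the read set `{b : Bʲ(b₋), Bʲ(b₊) ∈ {c₋, c₊}}` of `(j,c)` (the complex lines `Y + tV`, `Y + tV′` have the same
component, so the same velocity; every complete normed `ℂ`-algebra `𝔸`).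
§1b ★★ `norm_fderiv_chartC_apply_le_reads` — (72) LOCALISED: for a nested family with the collar property, the level weights `w`, `12800ℓ²LR′ ≤ 1`, `Y` of weighted size
`≤ r` (`8r ≤ R′`) and ANY `V` of weighted size `≤ ρ` ON THE READ SET of `(j,c)`: `‖(D chartLog(Y) − D chartLog(0))V (j,c)‖ ≤ (3840ℓL∕R′)·ρ·r` (g3's global (72) on the
restricted direction; `[NormOneClass 𝔸]`).
§2 ★★ `chartD_fderiv_eq` — THE DERIVATIVE's FIXED-POINT IDENTITY: for ANY selector `Dfun` solving (49) `C(A − H·Dfun A) = Dfun A` (`C = chartLog − D chartLog(0)`) on the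
open weighted `ε`-ball, ANY ℂ-linear `H` (matrix fibre `M_n(ℂ)`), any `A′` of the ball whose chart point `X₀ = A′ − H·Dfun A′` lies in a weighted ball of analyticity, and
any Fréchet derivative `𝔇` of `Dfun` at `A′`: `𝔇W = 𝒞′_{X₀}(W − H𝔇W)`, `𝒞′_{X₀} = D chartLog(X₀) − D chartLog(0)` — (68)∕(70) as «(I + ℜ)𝔇 = 𝒞′» by differentiating
(49) along the open ball (chain rule + uniqueness of the derivative; no series, no smallness).

HONEST FRAMING: count-neutral helper; compositions of kernel theorems by name; bookkeeping toward (73) with decay (part 2); nothing of [15] Sects. D–F asserted; stub 1 ∕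
K0⁷ ∕ K1⁷ NOT closed; N07 NOT discharged; counts unmoved; one finite T⁴ programme at fixed ε — NOT continuum ∕ ℝ⁴ ∕ OS ∕ mass gap ∕ Clay: the Yang–Mills mass gap is NOT
proved by any of this; R4 closes the conditional rung `BalabanLadder.UV` only.  No `sorry`, no `def`, no `instance`, no `notation`.

References: [15] T. Bałaban, CMP 102 (1985) 277–309 [Balaban1985Variational] ((44)–(49) p.285, (63)–(72) pp.287–289, Prop. 3 p.289, (156) p.302); [4] = [B7] CMP 98
(1985) 17–51 [Balaban1985Averaging] ((9) p.18, Prop. 5 (156)–(157) p.42); [I] CMP 109 (1987) 249–301 [Balaban1987RG1] ((0.4) p.253).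
-/

noncomputable section

open scoped BigOperators Matrix.Norms.L2Operator
open NormedSpace Metric Set Filter Topology

namespace Summit.QuantumFields.YangMills.BalabanUVNodes.N07ChartDLocality

open Literature.MathematicalPhysics.QuantumFieldTheory.Balaban1983to89
open Literature.MathematicalPhysics.QuantumFieldTheory.Balaban1983to89.B6SectADomainsV1 (Domains)
open Literature.MathematicalPhysics.QuantumFieldTheory.Balaban1983to89.B6SectAOperatorsV1 (BondIdx)
open Literature.MathematicalPhysics.QuantumFieldTheory.Balaban1983to89.B5Eq118OneStroke (iterBlockOf)
open Summit.QuantumFields.YangMills.Theorems.K0FlatCubeOpsTextP (IsLevWeight levWeight_nonneg)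
open Summit.QuantumFields.YangMills.Theorems.Prop8Chart (chartLog chartLog_congr differentiableAt_chartLog_zero)
open Summit.QuantumFields.YangMills.BalabanUVNodes.N07ChartLogAnalytic (analyticOnNhd_chartLog_weightedBall
  norm_fderiv_chartLog_sub_fderiv_zero_le_weightedBall)

variable {P : Params}

/-! ## §1  Locality of the DERIVATIVE of the charted constraint: a direction is read only on the read set of the index -/

section Locality

variable {𝔸 : Type*} [NormedRing 𝔸] [NormedAlgebra ℂ 𝔸] [CompleteSpace 𝔸]

/-- **THE DERIVATIVE OF `A ↦ chartLog η D A (j,c)` READS A DIRECTION ONLY ON THE READ SET OF `(j,c)`**: if `V`, `V′` agree on every fine bond `b` whose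
`j`-fold block points `Bʲ(b₋)`, `Bʲ(b₊)` lie in `{c₋, c₊}`, then any Fréchet derivative `L` of the component map at any `Y` has `L V = L V′` — the two complex
lines `t ↦ Y + tV`, `t ↦ Y + tV′` give the SAME component (`Prop8Chart.chartLog_congr`), so their velocities at `t = 0` coincide.
[cite: Balaban1985Variational, (69) p.288, (156) p.302; Balaban1987RG1, (0.4) p.253] -/
theorem hasFDerivAt_chartLog_apply_eq_of_reads (η : ℝ) (D : Domains P) (idx : BondIdx D) {Y : PBond P 0 → 𝔸}
    {L : (PBond P 0 → 𝔸) →L[ℂ] 𝔸} (hL : HasFDerivAt (fun A : PBond P 0 → 𝔸 => chartLog η D A idx) L Y)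
    {V V' : PBond P 0 → 𝔸}
    (hVV' : ∀ b : PBond P 0, (iterBlockOf (idx.1.1 : ℕ) b.src = idx.1.2.src ∨ iterBlockOf (idx.1.1 : ℕ) b.src = idx.1.2.tgt) →
      (iterBlockOf (idx.1.1 : ℕ) b.tgt = idx.1.2.src ∨ iterBlockOf (idx.1.1 : ℕ) b.tgt = idx.1.2.tgt) → V b = V' b) :
    L V = L V' := by
  -- the two lines through `Y`
  have hline : ∀ W : PBond P 0 → 𝔸, HasDerivAt (fun t : ℂ => chartLog η D (Y + t • W) idx) (L W) 0 := by
    intro W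
    have hγ : HasDerivAt (fun t : ℂ => Y + t • W) W 0 := by
      simpa using ((hasDerivAt_id (0 : ℂ)).smul_const W).const_add Y
    have hY0 : Y + (0 : ℂ) • W = Y := by rw [zero_smul, add_zero]
    have hL' : HasFDerivAt (fun A : PBond P 0 → 𝔸 => chartLog η D A idx) L (Y + (0 : ℂ) • W) := by rw [hY0]; exact hL
    have h := hL'.comp_hasDerivAt (0 : ℂ) hγ
    rwa [Function.comp_def] at h
  have heq : (fun t : ℂ => chartLog η D (Y + t • V) idx) = fun t : ℂ => chartLog η D (Y + t • V') idx := by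
    funext t
    refine chartLog_congr η D idx fun b hbs hbt => ?_
    simp only [Pi.add_apply, Pi.smul_apply, hVV' b hbs hbt]
  have h1 := hline V
  rw [heq] at h1
  exact h1.unique (hline V')

/-- **THE SAME FOR THE FULL DERIVATIVE**: at a point of differentiability, `(D chartLog(Y) V)(j,c) = (D chartLog(Y) V′)(j,c)` whenever `V`, `V′` agree on the read
set of `(j,c)`. [cite: Balaban1985Variational, (69) p.288, (156) p.302] -/
theorem fderiv_chartLog_apply_eq_of_reads (η : ℝ) (D : Domains P) (idx : BondIdx D) {Y : PBond P 0 → 𝔸}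
    (hd : DifferentiableAt ℂ (chartLog η D : (PBond P 0 → 𝔸) → BondIdx D → 𝔸) Y) {V V' : PBond P 0 → 𝔸}
    (hVV' : ∀ b : PBond P 0, (iterBlockOf (idx.1.1 : ℕ) b.src = idx.1.2.src ∨ iterBlockOf (idx.1.1 : ℕ) b.src = idx.1.2.tgt) →
      (iterBlockOf (idx.1.1 : ℕ) b.tgt = idx.1.2.src ∨ iterBlockOf (idx.1.1 : ℕ) b.tgt = idx.1.2.tgt) → V b = V' b) :
    (fderiv ℂ (chartLog η D : (PBond P 0 → 𝔸) → BondIdx D → 𝔸) Y) V idx =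
      (fderiv ℂ (chartLog η D : (PBond P 0 → 𝔸) → BondIdx D → 𝔸) Y) V' idx := by
  have hcomp : HasFDerivAt (fun A : PBond P 0 → 𝔸 => chartLog η D A idx)
      ((ContinuousLinearMap.proj (R := ℂ) (φ := fun _ : BondIdx D => 𝔸) idx).comp
        (fderiv ℂ (chartLog η D : (PBond P 0 → 𝔸) → BondIdx D → 𝔸) Y)) Y :=
    (hasFDerivAt_pi'.mp hd.hasFDerivAt) idx
  have h := hasFDerivAt_chartLog_apply_eq_of_reads η D idx hcomp hVV'
  simpa only [ContinuousLinearMap.comp_apply, ContinuousLinearMap.proj_apply] using h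

end Locality

/-! ## §1b  (72) LOCALISED: the derivative of the nonlinear part at an index is controlled by the direction ON THE READ SET of that index -/

section Local72

variable {𝔸 : Type*} [NormedRing 𝔸] [NormedAlgebra ℂ 𝔸] [CompleteSpace 𝔸] [NormOneClass 𝔸]

/-- **(72) LOCALISED TO THE READ SET** «|Lʲη(δC_j∕δA)(Lʲη(A′ − HD(A′)))| ≤ … C₃ …» read for the kernel in `b`: for a nested family with the collar property, the level
weights `w`, a radius `R′ > 0` with `12800ℓ²LR′ ≤ 1`, a base point `Y` of weighted size `≤ r` (`8r ≤ R′`) and ANY direction `V` whose weighted size ON THE READ SET OF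
`(j,c)` is `≤ ρ`: `‖(D chartLog(Y) − D chartLog(0)) V (j,c)‖ ≤ (3840ℓL∕R′)·ρ·r` — g3's global (72) `norm_fderiv_chartLog_sub_fderiv_zero_le_weightedBall` applied to the
direction RESTRICTED to the read set, which §1 shows gives the same value. [cite: Balaban1985Variational, (69) p.288, (72)-(73) p.289; Balaban1985Averaging, Prop. 5 (156)-(157) p.42] -/
theorem norm_fderiv_chartC_apply_le_reads (k : ℕ) (D : Domains P) (hDk : D.k = k)
    (hcollar : ∀ (i : ℕ) (e : PBond P (i + 1)), D.LamBond (i + 1) e → ∀ z : Site P i, (blockOf z = e.src ∨ blockOf z = e.tgt) → z ∈ D.Om i)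
    {w : ℕ → PBond P 0 → ℝ} (hw : IsLevWeight P k D w) {R' : ℝ} (hR' : 12800 * (((P.d + 2) * P.L : ℕ) : ℝ) ^ 2 * (P.L : ℝ) * R' ≤ 1)
    (hR'0 : 0 < R') (Y V : PBond P 0 → 𝔸) {r ρ : ℝ} (hr0 : 0 ≤ r) (hr : 8 * r ≤ R') (hρ0 : 0 ≤ ρ)
    (hY : ∀ b, w 1 b * ‖Y b‖ ≤ r) (idx : BondIdx D)
    (hV : ∀ b : PBond P 0, (iterBlockOf (idx.1.1 : ℕ) b.src = idx.1.2.src ∨ iterBlockOf (idx.1.1 : ℕ) b.src = idx.1.2.tgt) →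
      (iterBlockOf (idx.1.1 : ℕ) b.tgt = idx.1.2.src ∨ iterBlockOf (idx.1.1 : ℕ) b.tgt = idx.1.2.tgt) → w 1 b * ‖V b‖ ≤ ρ) :
    ‖(fderiv ℂ (chartLog (((P.L : ℝ)⁻¹) ^ k) D : (PBond P 0 → 𝔸) → BondIdx D → 𝔸) Y) V idx -
        (fderiv ℂ (chartLog (((P.L : ℝ)⁻¹) ^ k) D : (PBond P 0 → 𝔸) → BondIdx D → 𝔸) 0) V idx‖ ≤
      3840 * (((P.d + 2) * P.L : ℕ) : ℝ) * (P.L : ℝ) / R' * ρ * r := by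
  classical
  -- the direction restricted to the read set of `idx`
  let V' : PBond P 0 → 𝔸 := fun b =>
    if (iterBlockOf (idx.1.1 : ℕ) b.src = idx.1.2.src ∨ iterBlockOf (idx.1.1 : ℕ) b.src = idx.1.2.tgt) ∧
        (iterBlockOf (idx.1.1 : ℕ) b.tgt = idx.1.2.src ∨ iterBlockOf (idx.1.1 : ℕ) b.tgt = idx.1.2.tgt) then V b else 0
  have hV'def : ∀ b, V' b = if (iterBlockOf (idx.1.1 : ℕ) b.src = idx.1.2.src ∨ iterBlockOf (idx.1.1 : ℕ) b.src = idx.1.2.tgt) ∧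
        (iterBlockOf (idx.1.1 : ℕ) b.tgt = idx.1.2.src ∨ iterBlockOf (idx.1.1 : ℕ) b.tgt = idx.1.2.tgt) then V b else 0 := fun _ => rfl
  have hwnn : ∀ b, 0 ≤ w 1 b := fun b => by
    rw [hw 1 b, pow_one]
    exact mul_nonneg (pow_nonneg (Nat.cast_nonneg _) _) (pow_nonneg (inv_nonneg.2 (Nat.cast_nonneg _)) _)
  have hW : ∀ b, w 1 b * ‖V' b‖ ≤ ρ := by
    intro b
    by_cases hb : (iterBlockOf (idx.1.1 : ℕ) b.src = idx.1.2.src ∨ iterBlockOf (idx.1.1 : ℕ) b.src = idx.1.2.tgt) ∧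
        (iterBlockOf (idx.1.1 : ℕ) b.tgt = idx.1.2.src ∨ iterBlockOf (idx.1.1 : ℕ) b.tgt = idx.1.2.tgt)
    · rw [hV'def b, if_pos hb]; exact hV b hb.1 hb.2
    · rw [hV'def b, if_neg hb, norm_zero, mul_zero]; exact hρ0
  have hagree : ∀ b : PBond P 0, (iterBlockOf (idx.1.1 : ℕ) b.src = idx.1.2.src ∨ iterBlockOf (idx.1.1 : ℕ) b.src = idx.1.2.tgt) →
      (iterBlockOf (idx.1.1 : ℕ) b.tgt = idx.1.2.src ∨ iterBlockOf (idx.1.1 : ℕ) b.tgt = idx.1.2.tgt) → V b = V' b :=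
    fun b hs ht => by rw [hV'def b, if_pos ⟨hs, ht⟩]
  -- differentiability at `Y` (analytic on the weighted ball) and at `0`
  have han := analyticOnNhd_chartLog_weightedBall (𝔸 := 𝔸) k D hDk hcollar hw hR'
  have hYball : ∀ b, w 1 b * ‖Y b‖ < R' := fun b => (hY b).trans_lt (by linarith)
  have hdY : DifferentiableAt ℂ (chartLog (((P.L : ℝ)⁻¹) ^ k) D : (PBond P 0 → 𝔸) → BondIdx D → 𝔸) Y := (han Y hYball).differentiableAt
  have hd0 : DifferentiableAt ℂ (chartLog (((P.L : ℝ)⁻¹) ^ k) D : (PBond P 0 → 𝔸) → BondIdx D → 𝔸) 0 := differentiableAt_chartLog_zero _ D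
  rw [fderiv_chartLog_apply_eq_of_reads _ D idx hdY hagree, fderiv_chartLog_apply_eq_of_reads _ D idx hd0 hagree]
  exact norm_fderiv_chartLog_sub_fderiv_zero_le_weightedBall k D hDk hcollar hw hR' hR'0 Y V' hr0 hr hρ0 hY hW idx

end Local72

/-! ## §2  The derivative's fixed-point identity `𝔇 = 𝒞′_{X₀}∘(1 − H∘𝔇)` — (68)∕(70) without the Neumann series -/

section DerivIdentity

variable {n : Type*} [Fintype n] [DecidableEq n] [Nonempty n]

/-- **THE FRÉCHET DERIVATIVE OF THE CHART SOLVES THE LINEARISED (49)**: for ANY selector `Dfun` solving (49) `C(A − H·Dfun A) = Dfun A` (`C = chartLog − D chartLog(0)`)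
on the open weighted `ε`-ball, ANY ℂ-linear `H`, any `A′` in the ball whose chart point `X₀ = A′ − H·Dfun A′` lies in a weighted ball of analyticity of `chartLog`
(`12800ℓ²LR_b ≤ 1`), and any Fréchet derivative `𝔇` of `Dfun` at `A′`:  `𝔇W = 𝒞′_{X₀}(W − H𝔇W)` with `𝒞′_{X₀} = D chartLog(X₀) − D chartLog(0)` — i.e. «(I + ℜ)𝔇 = 𝒞′»,
`ℜ = 𝒞′_{X₀}H` ((68)–(70) p. 288–289), obtained by differentiating (49) along the open ball (chain rule + uniqueness of the derivative); no series, no smallness.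
[cite: Balaban1985Variational, (49) p.285, (63)-(70) pp.287-289] -/
theorem chartD_fderiv_eq (k : ℕ) (D : Domains P) (hDk : D.k = k)
    (hcollar : ∀ (i : ℕ) (e : PBond P (i + 1)), D.LamBond (i + 1) e → ∀ z : Site P i, (blockOf z = e.src ∨ blockOf z = e.tgt) → z ∈ D.Om i)
    {w : ℕ → PBond P 0 → ℝ} (hw : IsLevWeight P k D w) {Rb : ℝ} (hRb : 12800 * (((P.d + 2) * P.L : ℕ) : ℝ) ^ 2 * (P.L : ℝ) * Rb ≤ 1)
    (H : (BondIdx D → Matrix n n ℂ) →ₗ[ℂ] (PBond P 0 → Matrix n n ℂ)) {ε : ℝ}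
    (Dfun : (PBond P 0 → Matrix n n ℂ) → (BondIdx D → Matrix n n ℂ))
    (h49 : ∀ A : PBond P 0 → Matrix n n ℂ, (∀ b, w 1 b * ‖A b‖ < ε) →
      chartLog (((P.L : ℝ)⁻¹) ^ k) D (A - H (Dfun A)) -
          (fderiv ℂ (chartLog (((P.L : ℝ)⁻¹) ^ k) D : (PBond P 0 → Matrix n n ℂ) → BondIdx D → Matrix n n ℂ) 0) (A - H (Dfun A)) = Dfun A)
    {A' : PBond P 0 → Matrix n n ℂ} (hA' : ∀ b, w 1 b * ‖A' b‖ < ε) (hX₀ : ∀ b, w 1 b * ‖(A' - H (Dfun A')) b‖ < Rb)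
    {𝔇 : (PBond P 0 → Matrix n n ℂ) →L[ℂ] (BondIdx D → Matrix n n ℂ)} (h𝔇 : HasFDerivAt Dfun 𝔇 A') (W : PBond P 0 → Matrix n n ℂ) :
    𝔇 W = (fderiv ℂ (chartLog (((P.L : ℝ)⁻¹) ^ k) D : (PBond P 0 → Matrix n n ℂ) → BondIdx D → Matrix n n ℂ) (A' - H (Dfun A'))) (W - H (𝔇 W)) -
      (fderiv ℂ (chartLog (((P.L : ℝ)⁻¹) ^ k) D : (PBond P 0 → Matrix n n ℂ) → BondIdx D → Matrix n n ℂ) 0) (W - H (𝔇 W)) := by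
  set cL := (chartLog (((P.L : ℝ)⁻¹) ^ k) D : (PBond P 0 → Matrix n n ℂ) → BondIdx D → Matrix n n ℂ) with hcLdef
  set Qlin := fderiv ℂ cL 0 with hQlin
  set X₀ := A' - H (Dfun A') with hX₀def
  -- `H` is continuous (finite dimensions)
  let Hc : (BondIdx D → Matrix n n ℂ) →L[ℂ] (PBond P 0 → Matrix n n ℂ) := LinearMap.toContinuousLinearMap H
  have hHc : ∀ X, Hc X = H X := fun _ => rfl
  -- the open weighted ball is a neighbourhood of `A′`
  have hopen : IsOpen {A : PBond P 0 → Matrix n n ℂ | ∀ b, w 1 b * ‖A b‖ < ε} := by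
    rw [Set.setOf_forall]
    exact isOpen_iInter_of_finite fun b =>
      isOpen_lt (continuous_const.mul (continuous_norm.comp (continuous_apply b))) continuous_const
  have hS : {A : PBond P 0 → Matrix n n ℂ | ∀ b, w 1 b * ‖A b‖ < ε} ∈ 𝓝 A' := hopen.mem_nhds hA'
  -- `chartLog` is differentiable at `X₀`
  have han := analyticOnNhd_chartLog_weightedBall (𝔸 := Matrix n n ℂ) k D hDk hcollar hw hRb
  have hcL : HasFDerivAt cL (fderiv ℂ cL X₀) X₀ := (han X₀ hX₀).differentiableAt.hasFDerivAt
  -- the inner map `A ↦ A − H·Dfun A`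
  have hG : HasFDerivAt (fun A : PBond P 0 → Matrix n n ℂ => A - H (Dfun A))
      (ContinuousLinearMap.id ℂ (PBond P 0 → Matrix n n ℂ) - Hc.comp 𝔇) A' := by
    have h1 : HasFDerivAt (fun A : PBond P 0 → Matrix n n ℂ => Hc (Dfun A)) (Hc.comp 𝔇) A' := Hc.hasFDerivAt.comp A' h𝔇
    exact (hasFDerivAt_id A').sub h1
  -- the composite `C(A − H·Dfun A)`
  have hCG : HasFDerivAt (fun A : PBond P 0 → Matrix n n ℂ => cL (A - H (Dfun A)) - Qlin (A - H (Dfun A)))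
      ((fderiv ℂ cL X₀ - Qlin).comp (ContinuousLinearMap.id ℂ (PBond P 0 → Matrix n n ℂ) - Hc.comp 𝔇)) A' := by
    have h2 : HasFDerivAt (fun Y : PBond P 0 → Matrix n n ℂ => cL Y - Qlin Y) (fderiv ℂ cL X₀ - Qlin) X₀ := hcL.sub Qlin.hasFDerivAt
    exact h2.comp A' hG
  -- (49) holds near `A′`, so this is a derivative of `Dfun`
  have hEq : Dfun =ᶠ[𝓝 A'] fun A : PBond P 0 → Matrix n n ℂ => cL (A - H (Dfun A)) - Qlin (A - H (Dfun A)) := by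
    filter_upwards [hS] with A hA using (h49 A hA).symm
  have h𝔇' := hCG.congr_of_eventuallyEq hEq
  have huniq := h𝔇.unique h𝔇'
  have h := congrArg (fun T : (PBond P 0 → Matrix n n ℂ) →L[ℂ] (BondIdx D → Matrix n n ℂ) => T W) huniq
  simp only [ContinuousLinearMap.comp_apply, FunLike.coe_sub, Pi.sub_apply, ContinuousLinearMap.id_apply, hHc] at h
  exact h

end DerivIdentity

end Summit.QuantumFields.YangMills.BalabanUVNodes.N07ChartDLocality

end
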